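import Mathlib.Data.ZMod.Basic
import Mathlib.Data.Nat.Factorization.Induction
import Mathlib.RingTheory.PrincipalIdealDomain
import Mathlib.RingTheory.Int.Basic
import Mathlib.Algebra.Ring.Parity
import Mathlib.Tactic.Ring
import Mathlib.Tactic.Linarith
import Mathlib.Tactic.LinearCombination
import HarnessLib

/-!
# Square roots modulo `n`: Hensel lifting and the Chinese remainder theorem

For an integer `a` and a modulus `n` write `IsSquare (a : ZMod n)`, i.e. `y² ≡ a (mod n)` is
solvable (`isSquare_intCast_zmod_iff`). We prove the local–global principle for squares modulo an
odd `n` coprime to `a`: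

* `exists_sq_sub_dvd_prime_pow` — **Hensel's lemma for square roots**: for an odd prime `p ∤ a`, a
  solution of `x² ≡ a (mod p)` lifts to a solution of `y² ≡ a (mod p^k)` with `y ≡ x (mod p)`,
  for every `k ≥ 1` (Newton step `y ↦ y + t p^k`, `2 y t ≡ (a − y²)/p^k (mod p)`);
* `isSquare_zmod_mul_of_coprime` — squares combine over coprime moduli (Mathlib's
  `ZMod.chineseRemainder`);
* `isSquare_zmod_of_forall_primeFactors` — for `n` odd and `a` with `p ∤ a` and `a` a square
  modulo `p` for every prime `p ∣ n`, `a` is a square modulo `n`;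
* `exists_sq_sub_dvd_four_mul` — consequently, if moreover `Δ ≡ 0` or `1 (mod 4)` then
  `b² ≡ Δ (mod 4a)` is solvable for odd `a > 0`: the first step of Lenstra–Pomerance's Lemma 2.10
  ("since all prime factors of `a` belong to `𝒫_Δ`, there exists `b ∈ ℤ` with `b² ≡ Δ mod 4a`"),
  J. Amer. Math. Soc. **5** (1992) p. 489, by which smooth numbers built from split primes give
  binary quadratic forms `(a, b, c)` of discriminant `Δ`.

Mathlib has square roots modulo primes (`legendreSym`, `ZMod.exists_sq_eq_neg_one_iff`, …) and
`ZMod.chineseRemainder`, but no lifting to prime powers (searched `IsSquare` with `ZMod (p ^`,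
`hensel`). Everything is proved.

## References

* H. W. Lenstra Jr., C. Pomerance, *A rigorous time bound for factoring integers*, J. Amer. Math.
  Soc. 5 (1992) 483–516, §2 (2.7) (prime forms: `b_p² ≡ Δ mod 4p`) and Lemma 2.10.
  [LenstraPomerance1992]
* I. Niven, H. S. Zuckerman, H. L. Montgomery, *An Introduction to the Theory of Numbers*, 5th ed.,
  §2.6 (Hensel's lemma), Thm 2.23.
-/

namespace Literature.NumberTheory.QuadraticFields

/-! ### Squares modulo `n` as divisibility -/

/-- `a` is a square in `ZMod n` iff `y² ≡ a (mod n)` has an integer solution. [folklore] -/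
theorem isSquare_intCast_zmod_iff (a : ℤ) (n : ℕ) :
    IsSquare (a : ZMod n) ↔ ∃ y : ℤ, (n : ℤ) ∣ y ^ 2 - a := by
  constructor
  · rintro ⟨r, hr⟩
    obtain ⟨y, rfl⟩ := ZMod.intCast_surjective r
    refine ⟨y, ?_⟩
    have h : ((y ^ 2 : ℤ) : ZMod n) = (a : ZMod n) := by push_cast; rw [hr, sq]
    rw [ZMod.intCast_eq_intCast_iff] at h
    exact h.symm.dvd
  · rintro ⟨y, hy⟩
    refine ⟨(y : ZMod n), ?_⟩
    have h : ((y ^ 2 : ℤ) : ZMod n) = (a : ZMod n) := by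
      rw [ZMod.intCast_eq_intCast_iff]
      exact (Int.modEq_iff_dvd.2 hy).symm
    push_cast at h
    rw [← h, sq]

/-! ### Hensel's lemma for square roots modulo odd prime powers -/

/-- One Newton step: from `p^k ∣ y² − a` (`k ≥ 1`, `p` an odd prime, `p ∤ a`) to
`p^(k+1) ∣ y'² − a` with `y' ≡ y (mod p^k)`. [folklore] -/
theorem hensel_step {p : ℕ} (hp : p.Prime) (hp2 : p ≠ 2) {a y : ℤ} (ha : ¬ (p : ℤ) ∣ a) {k : ℕ}
    (hk : 1 ≤ k) (hy : (p : ℤ) ^ k ∣ y ^ 2 - a) :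
    ∃ y' : ℤ, (p : ℤ) ^ (k + 1) ∣ y' ^ 2 - a ∧ (p : ℤ) ^ k ∣ y' - y := by
  have hpZ : Prime (p : ℤ) := Nat.prime_iff_prime_int.1 hp
  obtain ⟨m, hm⟩ := hy
  -- `p ∤ y` and `p ∤ 2`, so `2y` is invertible modulo `p`
  have hpy : ¬ (p : ℤ) ∣ y := by
    intro h
    apply ha
    have h2 : (p : ℤ) ∣ y ^ 2 := dvd_pow h two_ne_zero
    have h3 : (p : ℤ) ∣ y ^ 2 - a := (dvd_pow_self (p : ℤ) (by omega)).trans ⟨m, hm⟩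
    have := dvd_sub h2 h3
    simpa using this
  have hp2' : ¬ (p : ℤ) ∣ 2 := by
    intro h
    have : p ∣ 2 := by exact_mod_cast h
    rcases (Nat.dvd_prime Nat.prime_two).1 this with h1 | h1
    · exact hp.one_lt.ne' h1
    · exact hp2 h1
  have hcop : IsCoprime (p : ℤ) (2 * y) := by
    rw [hpZ.coprime_iff_not_dvd]
    intro h
    rcases hpZ.dvd_or_dvd h with h1 | h1
    · exact hp2' h1
    · exact hpy h1
  obtain ⟨u, v, huv⟩ := hcop
  -- choose `t` with `2 y t ≡ -m (mod p)`: `t = -m v`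
  refine ⟨y + (-(m * v)) * (p : ℤ) ^ k, ?_, ⟨-(m * v), by ring⟩⟩
  have key : (y + -(m * v) * (p : ℤ) ^ k) ^ 2 - a =
      (p : ℤ) ^ k * (m * (1 - v * (2 * y))) + (m * v) ^ 2 * (p : ℤ) ^ (2 * k) := by
    have : y ^ 2 - a = (p : ℤ) ^ k * m := hm
    rw [pow_mul]
    linear_combination this
  rw [key]
  refine dvd_add ?_ ?_
  · -- `1 - v (2y) = u p`
    have h1 : 1 - v * (2 * y) = u * p := by linear_combination -huv
    rw [h1, pow_succ]
    exact mul_dvd_mul_left _ ⟨m * u, by ring⟩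
  · have h2k : k + 1 ≤ 2 * k := by omega
    exact (pow_dvd_pow (p : ℤ) h2k).mul_left _

/-- **Hensel's lemma for square roots.** For an odd prime `p ∤ a` and `x` with `p ∣ x² − a`,
every `k ≥ 1` admits `y ≡ x (mod p)` with `p^k ∣ y² − a`. [folklore] -/
theorem exists_sq_sub_dvd_prime_pow {p : ℕ} (hp : p.Prime) (hp2 : p ≠ 2) {a x : ℤ}
    (ha : ¬ (p : ℤ) ∣ a) (hx : (p : ℤ) ∣ x ^ 2 - a) {k : ℕ} (hk : 1 ≤ k) :
    ∃ y : ℤ, (p : ℤ) ^ k ∣ y ^ 2 - a ∧ (p : ℤ) ∣ y - x := by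
  induction k, hk using Nat.le_induction with
  | base => exact ⟨x, by rwa [pow_one], by simp⟩
  | succ k hk ih =>
    obtain ⟨y, hy, hyx⟩ := ih
    obtain ⟨y', hy', hy'y⟩ := hensel_step hp hp2 ha hk hy
    refine ⟨y', hy', ?_⟩
    have h1 : (p : ℤ) ∣ y' - y := (dvd_pow_self (p : ℤ) (by omega)).trans hy'y
    have := dvd_add h1 hyx
    simpa using this

/-- In `ZMod` language: for an odd prime `p ∤ a`, if `a` is a square modulo `p` then it is a square
modulo `p^k`. [folklore] -/
theorem isSquare_zmod_prime_pow {p : ℕ} (hp : p.Prime) (hp2 : p ≠ 2) {a : ℤ}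
    (ha : ¬ (p : ℤ) ∣ a) (hsq : IsSquare (a : ZMod p)) (k : ℕ) :
    IsSquare (a : ZMod (p ^ k)) := by
  rcases Nat.eq_zero_or_pos k with rfl | hk
  · rw [pow_zero]
    exact ⟨0, Subsingleton.elim _ _⟩
  obtain ⟨x, hx⟩ := (isSquare_intCast_zmod_iff a p).1 hsq
  obtain ⟨y, hy, -⟩ := exists_sq_sub_dvd_prime_pow hp hp2 ha hx hk
  exact (isSquare_intCast_zmod_iff a (p ^ k)).2 ⟨y, by exact_mod_cast hy⟩

/-! ### Chinese remainder theorem for squares -/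

/-- Squares modulo coprime `m`, `n` give a square modulo `m n`. [folklore] -/
theorem isSquare_zmod_mul_of_coprime {m n : ℕ} (h : m.Coprime n) {a : ℤ}
    (hm : IsSquare (a : ZMod m)) (hn : IsSquare (a : ZMod n)) : IsSquare (a : ZMod (m * n)) := by
  obtain ⟨r, hr⟩ := hm
  obtain ⟨s, hs⟩ := hn
  set e := ZMod.chineseRemainder h with he
  refine ⟨e.symm (r, s), ?_⟩
  apply e.injective
  rw [map_mul, RingEquiv.apply_symm_apply, map_intCast, Prod.mk_mul_mk, ← hr, ← hs]
  rfl

/-- **Local–global for squares modulo odd `n`.** If `n` is odd and, for every prime `p ∣ n`,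
`p ∤ a` and `a` is a square modulo `p`, then `a` is a square modulo `n`. [folklore] -/
theorem isSquare_zmod_of_forall_primeFactors {n : ℕ} (hn : Odd n) {a : ℤ}
    (ha : ∀ p ∈ n.primeFactors, ¬ (p : ℤ) ∣ a)
    (hsq : ∀ p ∈ n.primeFactors, IsSquare (a : ZMod p)) : IsSquare (a : ZMod n) := by
  induction n using Nat.recOnPosPrimePosCoprime with
  | zero => exact absurd hn (by decide)
  | one => exact ⟨0, Subsingleton.elim _ _⟩
  | prime_pow p k hp hk =>
    have hp' := hp
    have hmem : p ∈ (p ^ k).primeFactors :=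
      Nat.mem_primeFactors.2 ⟨hp, dvd_pow_self p hk.ne', pow_ne_zero k hp.ne_zero⟩
    have hp2 : p ≠ 2 := by
      rintro rfl
      exact (Nat.not_even_iff_odd.2 hn) (Nat.even_pow.2 ⟨even_two, hk.ne'⟩)
    exact isSquare_zmod_prime_pow hp hp2 (ha p hmem) (hsq p hmem) k
  | coprime m n hm hn' hmn ihm ihn =>
    have hm0 : m ≠ 0 := by omega
    have hn0 : n ≠ 0 := by omega
    have hodd : Odd m ∧ Odd n := Nat.odd_mul.1 hn
    refine isSquare_zmod_mul_of_coprime hmn (ihm hodd.1 ?_ ?_) (ihn hodd.2 ?_ ?_)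
    · exact fun p hp => ha p (Nat.primeFactors_mul hm0 hn0 ▸ Finset.mem_union_left _ hp)
    · exact fun p hp => hsq p (Nat.primeFactors_mul hm0 hn0 ▸ Finset.mem_union_left _ hp)
    · exact fun p hp => ha p (Nat.primeFactors_mul hm0 hn0 ▸ Finset.mem_union_right _ hp)
    · exact fun p hp => hsq p (Nat.primeFactors_mul hm0 hn0 ▸ Finset.mem_union_right _ hp)

/-! ### Square roots of a discriminant modulo `4a` -/

/-- **Lenstra–Pomerance, Lemma 2.10, first step.** Let `Δ ≡ 0` or `1 (mod 4)` and let `a` be odd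
with every prime `p ∣ a` satisfying `p ∤ Δ` and `Δ` a square modulo `p` (i.e. `p ∈ 𝒫_Δ`). Then
there is `b ∈ ℤ` with `b² ≡ Δ (mod 4a)`. [cite: LenstraPomerance1992, §2 Lemma 2.10 (proof)] -/
theorem exists_sq_sub_dvd_four_mul {Δ : ℤ} (hΔ : Δ % 4 = 0 ∨ Δ % 4 = 1) {a : ℕ} (ha : Odd a)
    (hsplit : ∀ p ∈ a.primeFactors, ¬ (p : ℤ) ∣ Δ ∧ IsSquare (Δ : ZMod p)) :
    ∃ b : ℤ, (4 * a : ℤ) ∣ b ^ 2 - Δ := by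
  obtain ⟨y, hy⟩ := (isSquare_intCast_zmod_iff Δ a).1
    (isSquare_zmod_of_forall_primeFactors ha (fun p hp => (hsplit p hp).1) fun p hp => (hsplit p hp).2)
  have hcopN : Nat.Coprime 4 a := by
    have h2 : Nat.Coprime 2 a := Nat.coprime_two_left.2 ha
    simpa using h2.pow_left 2
  have hcop : IsCoprime (4 : ℤ) (a : ℤ) := by
    have := Nat.isCoprime_iff_coprime.2 hcopN
    simpa using this
  obtain ⟨k, hk⟩ := ha
  -- adjust the parity: `b = y + a (Δ - y) = Δ + 2 k (Δ - y) ≡ Δ (mod 2)`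
  refine ⟨y + a * (Δ - y), ?_⟩
  set w : ℤ := k * (Δ - y) with hw
  have hb : y + (a : ℤ) * (Δ - y) = Δ + 2 * w := by rw [hk, hw]; push_cast; ring
  rw [hb]
  refine hcop.mul_dvd ?_ ?_
  · -- modulo 4: `(Δ + 2w)² − Δ = Δ(Δ − 1) + 4(wΔ + w²)` and `4 ∣ Δ(Δ − 1)`
    have h4 : (4 : ℤ) ∣ Δ * (Δ - 1) := by
      rcases hΔ with h | h
      · exact (Int.dvd_of_emod_eq_zero h).mul_right _
      · have h' : (4 : ℤ) ∣ Δ - 1 := by omega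
        exact h'.mul_left _
    have e : (Δ + 2 * w) ^ 2 - Δ = Δ * (Δ - 1) + 4 * (w * Δ + w ^ 2) := by ring
    rw [e]
    exact dvd_add h4 (Dvd.intro _ rfl)
  · -- modulo `a`: `Δ + 2w = y + a (Δ - y) ≡ y (mod a)`
    have e : (Δ + 2 * w) ^ 2 - Δ = (y ^ 2 - Δ) + a * ((Δ - y) * (2 * y + a * (Δ - y))) := by
      rw [← hb]; ring
    rw [e]
    exact dvd_add hy (Dvd.intro _ rfl)

end Literature.NumberTheory.QuadraticFields
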